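import Summits.Ventures.WeilGRH.UniformConductorFloor
import HarnessLib

/-!
# GRH arm (rh-explicit, venture WeilGRH): the uniform conductor floor with a CELL certificate for the primes

Cell `rh-explicit`, WEIL TRACK — GRH ARM (weil-grh-1).  `UniformConductorFloor.lean` pays the twisted prime
term `|P_χ(k)| ≤ Σ_n (Λ(n)/√n)·2|k(log n)|`, `k = g ⋆ g̃`, shift by shift (`|k(L)| ≤ ‖g‖₂²`, halved on slivers).
The shifts compete for the same mass of `g`, and the optimal JOINT bound is the top of the spectrum of the
positivity-preserving operator `S⁺_t = Σ_n (Λ(n)/√n)(τ_{log n} + τ_{−log n})` compressed to `L²[-t, t]`.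
This file proves a certified upper bound for it by a weighted AM–GM inequality with a step weight
(Collatz–Wielandt / Schur test with a positive vector `φ` on `J` cells of `[-t, t]`):

* cells `C_j = [-t + jδ, -t + (j+1)δ)`, `δ = 2t/J`, cell index `j(x) = ⌊(x+t)/δ⌋ ∈ ℤ`; a vector
  `φ : ℤ → ℝ`, `φ_j > 0` for `0 ≤ j < J`, `φ_j = 0` otherwise; for a shift `L` with `sδ ≤ L ≤ (s+1)δ`
  the point `x − L` lies in `C_{j(x)−s−1} ∪ C_{j(x)−s}` and `y + L` in `C_{j(y)+s} ∪ C_{j(y)+s+1}`;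
* pointwise `2|g(x)||g(x−L)| ≤ (A_j/φ_j)|g(x)|² + (φ_j/A_j)|g(x−L)|²`, `A_j = max(φ_{j−s−1}, φ_{j−s})`,
  and after the substitution `y = x − L` the second weight is `≤ B_j/φ_j`, `B_j = max(φ_{j+s}, φ_{j+s+1})`
  (`UniformFloor.two_mul_integral_le_of_phi`);
* summing over the shifts with weights `w̄_n ≥ Λ(n)/√n`: if `Σ_n w̄_n (A_{n,j} + B_{n,j}) ≤ ρ φ_j` for
  `0 ≤ j < J` (a finite list of LINEAR inequalities in `φ`) then `Σ_n (Λ(n)/√n)·2|k(log n)| ≤ ρ‖g‖₂²`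
  and the floor theorem holds with the prime budget `ρ` (`UniformFloor.weilPositivityOnChar_of_phi_budget`,
  file `UniformConductorFloorCellsBudget.lean`): `log π − ψ(x) − Σ_{m<M}(1/(m+x) − 2t) + ρ ≤ log q ⇒ WeilPositivityOnChar χ t`.
  This file: the cell bookkeeping and the ONE-SHIFT inequality.

Certificates (`UniformConductorFloorCellsRungs.lean`): `ρ = 2.1503` at `t = 1` (`J = 40`; the shift-by-shift
budget was `3.4164`), `1.2553` at `4023/5000` (`J = 20`; was `1.9612`), `0.901` at `log 2` (`J = 40`; was `1.1244`).

## References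

* A. Weil (1952), (11) and the «lemme» p. 262 [Weil1952FormulesExplicites]; H. Yoshida (1992) §2, §6 [Yoshida1992];
  L. Collatz (1942) / H. Wielandt (1950), the quotient bound for non-negative operators. [folklore]
-/

noncomputable section

open Complex Filter Set MeasureTheory
open scoped Real Topology ComplexConjugate ArithmeticFunction.vonMangoldt

namespace Summit.Ventures.WeilGRH

open Literature.NumberTheory.LFunctions

namespace UniformFloor

variable {g : ℝ → ℂ}

/-! ## Cell index bookkeeping -/

/-- A point where `g ≠ 0` lies in the open window `(-t, t)`. [folklore] -/
theorem mem_Ioo_of_ne_zero (hg : IsWeilTest g) {t : ℝ} (hsupp : tsupport g ⊆ Icc (-t) t) {x : ℝ}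
    (hx : g x ≠ 0) : -t < x ∧ x < t := by
  have h := support_subset_Ioo_of_tsupport_subset_Icc hg.1.continuous hsupp (Function.mem_support.2 hx)
  exact ⟨h.1, h.2⟩

/-- The cell index of a point of `(-t, t)` lies in `[0, J)` (`δ = 2t/J`). [folklore] -/
theorem floor_mem_range {t : ℝ} (ht : 0 < t) {J : ℕ} (hJ : 0 < J) {x : ℝ} (hx : -t < x ∧ x < t) :
    0 ≤ ⌊(x + t) / (2 * t / J)⌋ ∧ ⌊(x + t) / (2 * t / J)⌋ < (J : ℤ) := by
  have hδ : 0 < 2 * t / J := by positivity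
  constructor
  · exact Int.floor_nonneg.2 (div_nonneg (by linarith [hx.1]) hδ.le)
  · rw [Int.floor_lt, div_lt_iff₀ hδ]
    have hJ' : (0 : ℝ) < J := by exact_mod_cast hJ
    have : (J : ℤ) * (2 * t / (J : ℝ)) = ((2 * t : ℝ)) := by
      push_cast; field_simp
    push_cast at this ⊢
    rw [this]
    linarith [hx.2]

/-- If `x − L > -t` and `sδ ≤ L` then the cell index of `x` is `≥ s`. [folklore] -/
theorem le_floor_of_shift {t δ L : ℝ} (hδ : 0 < δ) {s : ℤ} (hsL : (s : ℝ) * δ ≤ L) {x : ℝ}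
    (hx : -t < x - L) : s ≤ ⌊(x + t) / δ⌋ := by
  rw [Int.le_floor, le_div_iff₀ hδ]
  linarith

/-- The cell index of `y + L` is `j(y) + s` or `j(y) + s + 1` when `sδ ≤ L ≤ (s+1)δ`. [folklore] -/
theorem floor_add_shift {t δ L : ℝ} (hδ : 0 < δ) {s : ℤ} (hsL : (s : ℝ) * δ ≤ L)
    (hLs : L ≤ ((s : ℝ) + 1) * δ) (y : ℝ) :
    ⌊(y + L + t) / δ⌋ = ⌊(y + t) / δ⌋ + s ∨ ⌊(y + L + t) / δ⌋ = ⌊(y + t) / δ⌋ + s + 1 := by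
  set i := ⌊(y + t) / δ⌋ with hi
  have h1 : (i : ℝ) ≤ (y + t) / δ := Int.floor_le _
  have h2 : (y + t) / δ < i + 1 := Int.lt_floor_add_one _
  have e : (y + L + t) / δ = (y + t) / δ + L / δ := by ring
  have hL1 : (s : ℝ) ≤ L / δ := by rwa [le_div_iff₀ hδ]
  have hL2 : L / δ ≤ (s : ℝ) + 1 := by rwa [div_le_iff₀ hδ]
  rcases lt_or_ge ((y + L + t) / δ) ((i : ℝ) + s + 1) with h | h
  · left
    rw [Int.floor_eq_iff]
    push_cast
    constructor <;> linarith
  · right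
    rw [Int.floor_eq_iff]
    push_cast
    constructor <;> linarith

/-! ## Step weights: measurability and integrability -/

/-- A step weight `x ↦ F(⌊(x + t)/δ⌋)` is measurable. [folklore] -/
theorem measurable_step (F : ℤ → ℝ) (t δ : ℝ) : Measurable fun x : ℝ ↦ F ⌊(x + t) / δ⌋ :=
  (measurable_from_top (f := F)).comp (Int.measurable_floor.comp (by fun_prop))

/-- A bounded step weight times `|g(x − c)|²` is integrable. [folklore] -/
theorem integrable_step_mul (hg : IsWeilTest g) (F : ℤ → ℝ) {C : ℝ} (hF : ∀ i, |F i| ≤ C)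
    (t δ c : ℝ) : Integrable fun x : ℝ ↦ F ⌊(x + t) / δ⌋ * ‖g (x - c)‖ ^ 2 := by
  have hgc : Continuous g := hg.1.continuous
  have hI : Integrable (fun u : ℝ ↦ ‖g u‖ ^ 2) := by
    refine (hgc.norm.pow 2).integrable_of_hasCompactSupport ?_
    rw [pow_two]
    exact hg.2.norm.mul_right
  have hIc : Integrable (fun x : ℝ ↦ ‖g (x - c)‖ ^ 2) := hI.comp_sub_right c
  refine (hIc.const_mul C).mono' ?_ (Eventually.of_forall fun x ↦ ?_)
  · exact ((measurable_step F t δ).mul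
      ((hgc.comp (continuous_id.sub continuous_const)).norm.pow 2).measurable).aestronglyMeasurable
  · rw [Real.norm_eq_abs, abs_mul, abs_of_nonneg (by positivity : (0 : ℝ) ≤ ‖g (x - c)‖ ^ 2)]
    exact mul_le_mul_of_nonneg_right (hF _) (by positivity)

/-! ## One shift: the weighted AM–GM with a step weight -/

/-- Weighted AM–GM: `2ab ≤ (A/P) a² + (P/A) b²` for `A, P > 0`. [folklore] -/
theorem two_mul_le_div_add_div {a b A P : ℝ} (hA : 0 < A) (hP : 0 < P) :
    2 * a * b ≤ A / P * a ^ 2 + P / A * b ^ 2 := by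
  have hAP : 0 < A * P := mul_pos hA hP
  have key : 0 ≤ (A * a - P * b) ^ 2 := sq_nonneg _
  have e : A / P * a ^ 2 + P / A * b ^ 2 - 2 * a * b = (A * a - P * b) ^ 2 / (A * P) := by
    field_simp
    ring
  have : 0 ≤ A / P * a ^ 2 + P / A * b ^ 2 - 2 * a * b := by rw [e]; positivity
  linarith

/-- **ONE SHIFT.** `tsupport g ⊆ [-t, t]`, `δ = 2t/J`, `φ ≥ 0` with `φ_i ≥ Φ₀ > 0` on `[0, J)` and
`φ_i = 0` off `[0, J)`, `0 ≤ s`, `sδ ≤ L ≤ (s+1)δ`.  Then, with `j = ⌊(x+t)/δ⌋`,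
`2∫|g(x)||g(x−L)| dx ≤ ∫ [max(φ_{j−s−1}, φ_{j−s}) + max(φ_{j+s}, φ_{j+s+1})]/φ_j · |g(x)|² dx`.
[folklore] -/
theorem two_mul_integral_le_of_phi (hg : IsWeilTest g) {t : ℝ} (ht : 0 < t)
    (hsupp : tsupport g ⊆ Icc (-t) t) {J : ℕ} (hJ : 0 < J) (φ : ℤ → ℝ) {Φ₀ Φ₁ : ℝ} (hΦ₀ : 0 < Φ₀)
    (hφlo : ∀ i, 0 ≤ i → i < (J : ℤ) → Φ₀ ≤ φ i) (hφhi : ∀ i, φ i ≤ Φ₁)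
    (hφout : ∀ i, i < 0 ∨ (J : ℤ) ≤ i → φ i = 0) {L : ℝ} {s : ℤ} (hs : 0 ≤ s)
    (hsL : (s : ℝ) * (2 * t / J) ≤ L) (hLs : L ≤ ((s : ℝ) + 1) * (2 * t / J)) :
    2 * ∫ x : ℝ, ‖g x‖ * ‖g (x - L)‖ ≤
      ∫ x : ℝ, (max (φ (⌊(x + t) / (2 * t / J)⌋ - s - 1)) (φ (⌊(x + t) / (2 * t / J)⌋ - s)) +
          max (φ (⌊(x + t) / (2 * t / J)⌋ + s)) (φ (⌊(x + t) / (2 * t / J)⌋ + s + 1))) /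
        φ ⌊(x + t) / (2 * t / J)⌋ * ‖g x‖ ^ 2 := by
  set δ : ℝ := 2 * t / J with hδdef
  have hδ : 0 < δ := by positivity
  have hgc : Continuous g := hg.1.continuous
  -- sign facts about `φ`
  have hφ0 : ∀ i, 0 ≤ φ i := by
    intro i
    rcases lt_or_ge i 0 with h | h
    · rw [hφout i (Or.inl h)]
    · rcases lt_or_ge i (J : ℤ) with h' | h'
      · exact hΦ₀.le.trans (hφlo i h h')
      · rw [hφout i (Or.inr h')]
  have hΦ₁ : 0 < Φ₁ := by
    have h0 := hφlo 0 le_rfl (by exact_mod_cast hJ)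
    linarith [hφhi 0]
  -- the weights
  set A : ℤ → ℝ := fun j ↦ max (φ (j - s - 1)) (φ (j - s)) with hA
  set B : ℤ → ℝ := fun j ↦ max (φ (j + s)) (φ (j + s + 1)) with hB
  have hA0 : ∀ j, 0 ≤ A j := fun j ↦ (hφ0 _).trans (le_max_right _ _)
  have hB0 : ∀ j, 0 ≤ B j := fun j ↦ (hφ0 _).trans (le_max_right _ _)
  have hAhi : ∀ j, A j ≤ Φ₁ := fun j ↦ max_le (hφhi _) (hφhi _)
  have hBhi : ∀ j, B j ≤ Φ₁ := fun j ↦ max_le (hφhi _) (hφhi _)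
  -- every ratio of the form `u/v` with `u, v ∈ {0} ∪ [Φ₀, Φ₁]`, `u, v ≥ 0`, is `≤ Φ₁/Φ₀`
  have hval : ∀ i, φ i = 0 ∨ Φ₀ ≤ φ i := by
    intro i
    rcases lt_or_ge i 0 with h | h
    · exact Or.inl (hφout i (Or.inl h))
    · rcases lt_or_ge i (J : ℤ) with h' | h'
      · exact Or.inr (hφlo i h h')
      · exact Or.inl (hφout i (Or.inr h'))
  have hratio : ∀ {u v : ℝ}, 0 ≤ u → u ≤ Φ₁ → (v = 0 ∨ Φ₀ ≤ v) → |u / v| ≤ Φ₁ / Φ₀ := by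
    intro u v hu hu1 hv
    rcases hv with hv | hv
    · rw [hv, div_zero, abs_zero]; positivity
    · have hv0 : 0 < v := hΦ₀.trans_le hv
      rw [abs_of_nonneg (div_nonneg hu hv0.le), div_le_div_iff₀ hv0 hΦ₀]
      exact mul_le_mul hu1 hv hΦ₀.le hΦ₁.le
  have hAval : ∀ j, A j = 0 ∨ Φ₀ ≤ A j := by
    intro j
    rcases hval (j - s) with h | h
    · rcases hval (j - s - 1) with h' | h'
      · left; simp [hA, h, h']
      · right; exact h'.trans (le_max_left _ _)
    · right; exact h.trans (le_max_right _ _)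
  -- integrability of the three step integrands
  have hI1 : Integrable fun x : ℝ ↦ A ⌊(x + t) / δ⌋ / φ ⌊(x + t) / δ⌋ * ‖g (x - 0)‖ ^ 2 :=
    integrable_step_mul hg (fun j ↦ A j / φ j) (fun j ↦ hratio (hA0 j) (hAhi j) (hval j)) t δ 0
  have hI2 : Integrable fun x : ℝ ↦ φ ⌊(x + t) / δ⌋ / A ⌊(x + t) / δ⌋ * ‖g (x - L)‖ ^ 2 :=
    integrable_step_mul hg (fun j ↦ φ j / A j) (fun j ↦ hratio (hφ0 j) (hφhi j) (hAval j)) t δ L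
  have hI2' : Integrable fun y : ℝ ↦ φ ⌊(y + L + t) / δ⌋ / A ⌊(y + L + t) / δ⌋ * ‖g (y - 0)‖ ^ 2 := by
    have h := hI2.comp_add_right L
    refine h.congr (Eventually.of_forall fun y ↦ ?_)
    simp only [sub_zero, add_sub_cancel_right]
  have hI3 : Integrable fun x : ℝ ↦ B ⌊(x + t) / δ⌋ / φ ⌊(x + t) / δ⌋ * ‖g (x - 0)‖ ^ 2 :=
    integrable_step_mul hg (fun j ↦ B j / φ j) (fun j ↦ hratio (hB0 j) (hBhi j) (hval j)) t δ 0
  simp only [sub_zero] at hI1 hI2' hI3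
  have hI0 : Integrable fun x : ℝ ↦ ‖g x‖ * ‖g (x - L)‖ :=
    (hgc.norm.mul (hgc.comp (continuous_id.sub continuous_const)).norm).integrable_of_hasCompactSupport
      hg.2.norm.mul_right
  -- (1) pointwise AM–GM
  have hpt1 : ∀ x : ℝ, 2 * (‖g x‖ * ‖g (x - L)‖) ≤
      A ⌊(x + t) / δ⌋ / φ ⌊(x + t) / δ⌋ * ‖g x‖ ^ 2 +
        φ ⌊(x + t) / δ⌋ / A ⌊(x + t) / δ⌋ * ‖g (x - L)‖ ^ 2 := by
    intro x
    set j := ⌊(x + t) / δ⌋ with hj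
    have hrhs : 0 ≤ A j / φ j * ‖g x‖ ^ 2 + φ j / A j * ‖g (x - L)‖ ^ 2 := by
      have := hA0 j; have := hφ0 j; positivity
    by_cases hgx : g x = 0
    · have h0 : 2 * (‖g x‖ * ‖g (x - L)‖) = 0 := by rw [hgx, norm_zero, zero_mul, mul_zero]
      linarith
    by_cases hgL : g (x - L) = 0
    · have h0 : 2 * (‖g x‖ * ‖g (x - L)‖) = 0 := by rw [hgL, norm_zero, mul_zero, mul_zero]
      linarith
    have hxI := mem_Ioo_of_ne_zero hg hsupp hgx
    have hxLI := mem_Ioo_of_ne_zero hg hsupp hgL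
    obtain ⟨hj0, hjJ⟩ := floor_mem_range ht hJ hxI
    rw [← hδdef, ← hj] at hj0 hjJ
    have hφj : 0 < φ j := hΦ₀.trans_le (hφlo j hj0 hjJ)
    have hsj : s ≤ j := le_floor_of_shift hδ hsL hxLI.1
    have hAj : 0 < A j := by
      have h1 : Φ₀ ≤ φ (j - s) := hφlo (j - s) (by omega) (by omega)
      exact (hΦ₀.trans_le h1).trans_le (le_max_right _ _)
    have := two_mul_le_div_add_div (a := ‖g x‖) (b := ‖g (x - L)‖) hAj hφj
    linarith
  -- (2) the substituted weight is dominated by `B/φ`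
  have hpt2 : ∀ y : ℝ, φ ⌊(y + L + t) / δ⌋ / A ⌊(y + L + t) / δ⌋ * ‖g y‖ ^ 2 ≤
      B ⌊(y + t) / δ⌋ / φ ⌊(y + t) / δ⌋ * ‖g y‖ ^ 2 := by
    intro y
    by_cases hgy : g y = 0
    · simp [hgy]
    refine mul_le_mul_of_nonneg_right ?_ (by positivity)
    have hyI := mem_Ioo_of_ne_zero hg hsupp hgy
    obtain ⟨hi0, hiJ⟩ := floor_mem_range ht hJ hyI
    rw [← hδdef] at hi0 hiJ
    set i := ⌊(y + t) / δ⌋ with hi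
    have hφi : 0 < φ i := hΦ₀.trans_le (hφlo i hi0 hiJ)
    set j' := ⌊(y + L + t) / δ⌋ with hj'
    have hcases := floor_add_shift (t := t) hδ hsL hLs y
    rw [← hj', ← hi] at hcases
    -- `A j' ≥ φ i`, `φ j' ≤ B i`
    have hAj' : φ i ≤ A j' := by
      rcases hcases with h | h
      · have e : j' - s = i := by omega
        simp only [hA, e]; exact le_max_right _ _
      · have e : j' - s - 1 = i := by omega
        simp only [hA, e]; exact le_max_left _ _
    have hφj' : φ j' ≤ B i := by
      rcases hcases with h | h
      · have e : j' = i + s := by omega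
        simp only [hB, e]; exact le_max_left _ _
      · have e : j' = i + s + 1 := by omega
        simp only [hB, e]; exact le_max_right _ _
    have hAj'0 : 0 < A j' := hφi.trans_le hAj'
    calc φ j' / A j' ≤ φ j' / φ i := div_le_div_of_nonneg_left (hφ0 _) hφi hAj'
      _ ≤ B i / φ i := div_le_div_of_nonneg_right hφj' hφi.le
  -- (3) integrate
  have step1 : 2 * ∫ x : ℝ, ‖g x‖ * ‖g (x - L)‖ ≤
      (∫ x : ℝ, A ⌊(x + t) / δ⌋ / φ ⌊(x + t) / δ⌋ * ‖g x‖ ^ 2) +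
        ∫ x : ℝ, φ ⌊(x + t) / δ⌋ / A ⌊(x + t) / δ⌋ * ‖g (x - L)‖ ^ 2 := by
    rw [← integral_const_mul, ← integral_add hI1 hI2]
    exact integral_mono (hI0.const_mul 2) (hI1.add hI2) hpt1
  have step2 : ∫ x : ℝ, φ ⌊(x + t) / δ⌋ / A ⌊(x + t) / δ⌋ * ‖g (x - L)‖ ^ 2 =
      ∫ y : ℝ, φ ⌊(y + L + t) / δ⌋ / A ⌊(y + L + t) / δ⌋ * ‖g y‖ ^ 2 := by
    rw [← integral_add_right_eq_self
      (fun x : ℝ ↦ φ ⌊(x + t) / δ⌋ / A ⌊(x + t) / δ⌋ * ‖g (x - L)‖ ^ 2) L]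
    refine integral_congr_ae (Eventually.of_forall fun y ↦ ?_)
    simp only [add_sub_cancel_right]
  have step3 : ∫ y : ℝ, φ ⌊(y + L + t) / δ⌋ / A ⌊(y + L + t) / δ⌋ * ‖g y‖ ^ 2 ≤
      ∫ y : ℝ, B ⌊(y + t) / δ⌋ / φ ⌊(y + t) / δ⌋ * ‖g y‖ ^ 2 :=
    integral_mono hI2' hI3 hpt2
  have step4 : (∫ x : ℝ, A ⌊(x + t) / δ⌋ / φ ⌊(x + t) / δ⌋ * ‖g x‖ ^ 2) +
      ∫ y : ℝ, B ⌊(y + t) / δ⌋ / φ ⌊(y + t) / δ⌋ * ‖g y‖ ^ 2 =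
      ∫ x : ℝ, (A ⌊(x + t) / δ⌋ + B ⌊(x + t) / δ⌋) / φ ⌊(x + t) / δ⌋ * ‖g x‖ ^ 2 := by
    rw [← integral_add hI1 hI3]
    refine integral_congr_ae (Eventually.of_forall fun x ↦ ?_)
    simp only
    ring
  have : 2 * ∫ x : ℝ, ‖g x‖ * ‖g (x - L)‖ ≤
      ∫ x : ℝ, (A ⌊(x + t) / δ⌋ + B ⌊(x + t) / δ⌋) / φ ⌊(x + t) / δ⌋ * ‖g x‖ ^ 2 := by
    rw [← step4]; linarith
  simpa only [hA, hB] using this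

/-- `|k(L)| ≤ ∫ |g(x)||g(x − L)| dx` for `k = g ⋆ g̃`. [folklore] -/
theorem norm_weilConv_weilReflect_le_integral_mul (g : ℝ → ℂ) (L : ℝ) :
    ‖weilConv g (weilReflect g) L‖ ≤ ∫ x : ℝ, ‖g x‖ * ‖g (x - L)‖ := by
  rw [weilConv_apply]
  calc ‖∫ u : ℝ, g u * weilReflect g (L - u)‖
      ≤ ∫ u : ℝ, ‖g u * weilReflect g (L - u)‖ := norm_integral_le_integral_norm _
    _ = ∫ u : ℝ, ‖g u‖ * ‖g (u - L)‖ := by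
        congr 1 with u
        simp [weilReflect, neg_sub]

end UniformFloor

end Summit.Ventures.WeilGRH

end
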